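import Summits.BirchSwinnertonDyer.BirchSwinnertonDyer.Theses.PrintX9
import Summits.BirchSwinnertonDyer.BirchSwinnertonDyer.Theorems.PrintX9HowardContainmentLightFrameOfPrintDepthPosLocalized
import HarnessLib

/-!
# BC5 / T3 witness rung BY ID for route `PrintX9` (deciding crux stmt-BirchSwinnertonDyer-26359
# `HowardContainmentLightFramePinnedOfPrint`): the `p ∤ h_K` slice of the PINNED, TIED A-side, and its
# lever-regime (localized, any class number, depth-typed) companion — all from the route's OWN binders

HONEST FRAMING (tribunal-w seat `bsd-trib-w-tld` g5, cell `run/shared/lean/pub/bsd-print-x9/`; D-0033 T3,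
`docs/architecture/tribunal.md` §T3; director-bsd (161)(b) ruling (β): route `TorsionLayerDescent` is being
re-typed to this pinned shape and closed `superseded --by route-BirchSwinnertonDyer-PrintX9`, so the row-9
witness question moves to THIS route). The deciding crux of `PrintX9` (rev 20–24) is
`HowardContainmentLightFramePinnedOfPrint := MastellaZermanHowardDivisibility → CGLSHowardDivisibilityLocalized →
AnticyclotomicTowerInRingClassFields → HowardContainmentLightFramePinned`: GRANTED by name the three printed
inputs (binders `hMZ`, `hCGLS`, `hTw` of the route's `closes`), Howard's Theorem-B containment
`I(ℋ_F)² ⊆ char_Λ(X_tors)` on every rank-one LIGHT X9 Heegner frame (`d_K` odd `≠ -3`, `p` split, (irr_K),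
`rank E(K) = 1`, `Ш(E/K)[p^∞]` finite) for the frame's OWN parametrisation `Dt` with `p`-adic-unit Manin
constant (PIN-1: binder `¬ (p : ℤ) ∣ Dt.c`, TIED conclusion `∃ jbar D F X, F.Dt = Dt ∧ …`), with NO
hypothesis on the class number `h_K`.

The route's `tribunal_fit.witness` of record, `Rank1Residual.X9.heegnerContainment_of_cor46`, is a
route-free typer-tree theorem in the UNTIED letter of rev ≤ 19 (kernel 2026-08-28T08:0xZ, rev 24, quick:
`t3k present, clean=True, witness_mentions_crux=false`). This file states and proves, over the route's own
decls (so the kernel sees the crux's binders BY NAME), and WITHOUT importing any other route's `Theses` file: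

* §2 `heegnerContainmentAt_lightTied_of_mastellaZerman` — the `p ∤ h_K` slice at a GIVEN `jbar`, TIED
  (`F.Dt = Dt`), from `hMZ` alone (Mastella–Zerman 2026 Cor. 4.6 at the hypothesis structure
  `ClassX9.mz26Hypotheses`, the family ON `Dt` by the Literature theorem `exists_heegnerFamily_Dt_eq_holds`).
* §3 `rung_lightPinned_coprimeClassNumber` — THE RUNG: the letter of `HowardContainmentLightFramePinned`
  with ONE extra hypothesis `¬ p ∣ NumberField.classNumber K`, from `hMZ` alone (`jbar := IsAlgClosed.lift`
  along `ιC`); `rung_isSlice_lightPinned` — the pinned A-side `HowardContainmentLightFramePinned` (the crux's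
  CONCLUSION; `h hMZ hCGLS hTw` for the rev-20–24 binders) specialises to the rung's statement (kernel certificate
  that the rung IS the `p ∤ h_K` special case of the crux BY ID).
* §4 `stmt_coprimeTied` — the statement `Stmt.coprimeTied` of the registered skeleton of record on
  stmt-26359 (`plan/skeletons/rev20-torsion-depth-pinned/torsion-depth-pinned.lean`, sha256 b026ade8…,
  x9-p1 LEAD re-cut) VERBATIM, proved here route-internally (the skeleton's in-file proof goes through
  `Theorems.TorsionLayerDescentRungCoprime`, a module importing route TLD's `Theses` file).
* §5 LEVER REGIME by ID: `stabilizedLocalizedContainmentAt_tied_of_thm413_of_tower` /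
  `rung_lightPinned_localizedTied` (= the skeleton's `Stmt.localizedTied`, any class number, any depth) /
  `rung_lightPinned_depthPos_localizedTied` (first torsion layer `K_1 ⊆ K[1]` TYPED, depth of the produced
  CGLS datum CERTIFIED positive) — from `hCGLS` (CGLS 2022 Thm. 4.1.3, localized at `p`) and `hTw` (the
  tower `K_k ⊂ K[p^d]`), the datum `C` ON `Dt` by x9-p2's `X9.exists_stabilizedHeegnerData_of_tower`.
* §6 `rung_twoRegimes_lightPinned` — both regimes of the deciding crux exercised from its three binders.

WHAT THIS IS AND IS NOT (numbers, not adjectives). §2–§4: PRINT regime (MZ26 Cor. 4.6: Howard Thm. B under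
(irr) + scalar `1 + pℤ_p` image — a tree THEOREM on X9, Lombardo–Tronto 2022 Thm. 3.16 — + `p ∤ h_K`),
INTEGRAL, tied. §5: PRINT modulo typing, LOCALIZED at `p` (`p^m`), for CGLS's stabilised module `Λκ_∞(C)`,
not for `ℋ_F`. Both lie OUTSIDE the known regime of the route's target `Rank1Residual.BSDpOnClassX9` (open in
the kernel — `s_case found=false` — and in print: BCS 2025 Thm. 1.1.2 (b) needs (sur)/(im), violated on X9).
NOT touched: the envelope `ℋ_F ⊆ Λκ_∞(C)` up to `p^e` (stub `stub_envelopeTied`, x9-p2) and the μ-part at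
`p ∣ h_K` for the pinned family (stub `stub_muPartTied`, x9-p1 LEAD; BEYOND PRINT — the cell's named
residual). No summit statement, no leaf, no crux is proved by this file; BSD is NOT proved.
«beyond-print theorem»: no.

ROBUSTNESS (cell referee REF-117, 2026-08-28T08:10Z — repairs R1 = re-body support item 25234 as
`thm413_… ∧ thm411_…`, or R2 = a fourth crux binder, under consideration by the pen): every use of `hCGLS` here
goes through `thm413_of_cglsHowardDivisibilityLocalized`, proved by `first | exact hCGLS | exact And.left hCGLS`
(elaborates under the present body and under R1); the witness §3 and §2/§4 depend on the `hMZ` binder only; the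
slice certificate is typed over the A-side, not over the crux's binder list — so neither R1 nor R2 requires a
patch of this file. (Dependents that DO carry a one-token R1 patch site: p607064
`PrintX9HowardContainmentLightFrameOfPrintDepthPosLocalized` l.253 `h413 : … := hCGLS`; the skeleton of record's
`localizedTied_of_print`.)

References: [MastellaZerman2026] Cor. 4.6, Assumptions 2.1, 2.13 (v) (arXiv:2505.08710);
[LombardoTronto2022] Thm. 3.16; [Howard2004HeegnerKolyvagin] Thm. B, §2.7, §3.3;
[CastellaGrossiLeeSkinner2022] Thm. 4.1.1 (proof, d(k)), Thm. 4.1.3, Cor. 3.4.2, Rem. 4.1.4 (arXiv:2008.02571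
p. 22); [PerrinRiou1987BSMF] §0–§1; [BurungaleCastellaSkinner2025] Thm. 1.1.2 (b) (arXiv:2405.00270);
[GreenbergLNM1716] §1; [Mazur1978] (Manin constant at good odd p).
-/

set_option autoImplicit false
set_option linter.dupNamespace false

noncomputable section

open scoped Classical

open WeierstrassCurve NumberField Literature Literature.NumberTheory.EllipticCurves
  Literature.NumberTheory.EllipticCurves.ModularForms
  Summit.BirchSwinnertonDyer.BirchSwinnertonDyer.Theses.PrintX9

namespace Summit.BirchSwinnertonDyer.BirchSwinnertonDyer.Theorems.PrintX9Rung

/-! ## §1 The CGLS route binder IS the named fact (universe 0, REF-117-robust unfold); `d_K` odd excludes `-4` -/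

set_option linter.unreachableTactic false in
set_option linter.unusedTactic false in
/-- The item body `PrintX9.CGLSHowardDivisibilityLocalized` (stmt-BirchSwinnertonDyer-25234, binder `hCGLS`) is,
definitionally (rev 20–24), the named fact `CastellaGrossiLeeSkinner2022.thm413_rankOne_charIdeal_torsion_dvd_localized`
at universe `0`. ROBUSTNESS (cell referee REF-117, 2026-08-28T08:10Z, repair R1 under consideration: re-body the
support item as the conjunction `thm413_… ∧ thm411_…` BY NAME): the proof is `first | exact hCGLS | exact And.left hCGLS`,
so this file — whose every use of `hCGLS` goes through this lemma — elaborates unchanged under the present body AND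
under the R1 conjunction; under R2 (a fourth crux binder, item 25234 untouched) nothing here changes either.
[cite: CastellaGrossiLeeSkinner2022, Thm. 4.1.3 with Cor. 3.4.2 and Rem. 4.1.4 (arXiv:2008.02571)] -/
theorem thm413_of_cglsHowardDivisibilityLocalized (hCGLS : CGLSHowardDivisibilityLocalized) :
    CastellaGrossiLeeSkinner2022.thm413_rankOne_charIdeal_torsion_dvd_localized.{0} := by
  first
  | exact hCGLS
  | exact And.left hCGLS

/-- An odd discriminant is not `-4` (the light frame's `Odd d_K` discharges Mastella–Zerman's `d_K ≠ -4`).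
[folklore] -/
theorem discr_ne_neg_four_of_odd {K : Type} [Field K] [NumberField K]
    (hodd : Odd (NumberField.discr K)) : NumberField.discr K ≠ -4 := by
  intro h4
  rw [h4] at hodd
  exact (Int.not_odd_iff_even.mpr ⟨-2, by norm_num⟩) hodd

/-! ## §2 Print regime at a GIVEN `jbar`, TIED: `p ∤ h_K` -/

/-- **The `p ∤ h_K` slice of the pinned A-side on a light X9 frame, for the TIED family and a GIVEN `jbar`**:
data `D`, `X` by the tree's existence theorems, a Heegner family `F` ON the frame's `Dt` (orientation `H.β`)
by `exists_heegnerFamily_Dt_eq_holds`, and the divisibility `char_Λ(X_tors) ∣ I(ℋ_F)²` by Mastella–Zerman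
2026 Cor. 4.6 BY NAME (`hMZ`) at `ClassX9.mz26Hypotheses` (scalar image = the tree theorem
`ClassX9.hasPadicScalarImage`). Rank / Ш / (irr_K) / the pin are not needed here and not assumed.
[cite: MastellaZerman2026, Cor. 4.6, Assumptions 2.1 and 2.13 (v) (arXiv:2505.08710)]
[cite: LombardoTronto2022, Thm. 3.16] [cite: Howard2004HeegnerKolyvagin, Thm. B, §2.7, §3.3] -/
theorem heegnerContainmentAt_lightTied_of_mastellaZerman (hMZ : MastellaZermanHowardDivisibility)
    {W : WeierstrassCurve ℚ} [W.IsElliptic] [W.IsGloballyMinimal] {p : ℕ} [Fact p.Prime]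
    [NeZero (W.conductorNorm ℤ)] {K : Type} [Field K] [NumberField K]
    (hX9 : Summit.BirchSwinnertonDyer.BirchSwinnertonDyer.Rank1Residual.ClassX9 W p)
    (hK : IsImaginaryQuadratic K) (hodd : Odd (NumberField.discr K)) (h3 : NumberField.discr K ≠ -3)
    (hHN : SatisfiesHeegnerHypothesis (W.conductorNorm ℤ) K) (hHp : SatisfiesHeegnerHypothesis p K)
    (hhK : ¬ p ∣ NumberField.classNumber K)
    (κ : ZpExtension K p) (hκ : κ.IsAnticyclotomic)
    (γ : Field.absoluteGaloisGroup K) (hγ : κ.IsTopGenerator γ)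
    (Dt : ModularParametrizationData W (W.conductorNorm ℤ))
    (H : HeegnerDatum (W.conductorNorm ℤ) (NumberField.discr K))
    (jbar : AlgebraicClosure K →+* ℂ) :
    ∃ (D : (W.baseChange K).LambdaAdicSelmerData κ γ)
      (F : HeegnerFamily (W.conductorNorm ℤ) W K κ jbar) (X : (W.baseChange K).SelmerDualData κ γ),
      F.Dt = Dt ∧ heegnerCharIdeal D F ^ 2 ≤
        Module.charIdeal (IwasawaAlgebra p) (Submodule.torsion (IwasawaAlgebra p) X.X) := by
  have hX9' :=
    Summit.BirchSwinnertonDyer.BirchSwinnertonDyer.Rank1Residual.classX9_census_of_classX9 W p hX9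
  obtain ⟨D⟩ := LambdaAdicSelmerDataExists.nonempty_lambdaAdicSelmerData (W.baseChange K) p κ hγ
  obtain ⟨X⟩ := (W.baseChange K).nonempty_selmerDualData_holds κ γ hγ
  obtain ⟨F, hFDt, -⟩ := exists_heegnerFamily_Dt_eq_holds hK hHN hX9'.not_dvd_conductorNorm κ Dt
    H.dvd_sq_sub jbar
  -- the binder body `PrintX9.MastellaZermanHowardDivisibility` (item 25233) IS, definitionally, the cite-only
  -- named fact `MastellaZerman2026.cor46_howardDivisibility_of_scalarImage.{0}` (the unfolding lemma is already
  -- landed in the TLD cone as `TorsionLayerDescentRung.cor46_of_mastellaZermanHowardDivisibility`; not imported)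
  exact ⟨D, F, X, hFDt, Ideal.le_of_dvd (MastellaZerman2026.conclusion_of_cor46 (jbar := jbar)
    (show MastellaZerman2026.cor46_howardDivisibility_of_scalarImage.{0} from hMZ)
    (hX9'.mz26Hypotheses κ γ hK ⟨h3, discr_ne_neg_four_of_odd hodd⟩ hHN hHp hhK hκ hγ) D F X)⟩

/-! ## §3 THE RUNG (letter of `HowardContainmentLightFramePinned` + one hypothesis) and its by-ID certificate -/

/-- **THE RUNG — BC5/T3 witness BY ID for crux stmt-BirchSwinnertonDyer-26359.** The letter of the route's
`HowardContainmentLightFramePinned` (A^pin: light X9 frame, binder `¬ (p : ℤ) ∣ Dt.c`, rank one, `Ш[p^∞]`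
finite, TIED conclusion `∃ jbar D F X, F.Dt = Dt ∧ I(ℋ_F)² ⊆ char_Λ(X_tors)`) with ONE extra hypothesis
`¬ p ∣ NumberField.classNumber K`, proved from the route binder `hMZ` ALONE (`jbar := IsAlgClosed.lift` along
`ιC`; the pin, rank, Ш and (irr_K) binders are carried for the letter and not used). PRINT regime; the lever
`p ∣ h_K` is §5's business; BSD / BSD_p(X9) / the crux are NOT proved.
[cite: MastellaZerman2026, Cor. 4.6 (arXiv:2505.08710)] [cite: Howard2004HeegnerKolyvagin, Thm. B]
[cite: Mazur1978, (Manin constant a p-adic unit at good odd p)] -/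
theorem rung_lightPinned_coprimeClassNumber (hMZ : MastellaZermanHowardDivisibility) :
    ∀ (W : WeierstrassCurve ℚ) [W.IsElliptic] [W.IsGloballyMinimal] (p : ℕ) [Fact p.Prime]
      [NeZero (W.conductorNorm ℤ)] (K : Type) [Field K] [NumberField K],
      Summit.BirchSwinnertonDyer.BirchSwinnertonDyer.Rank1Residual.ClassX9 W p →
      IsImaginaryQuadratic K → Odd (NumberField.discr K) → NumberField.discr K ≠ -3 →
      SatisfiesHeegnerHypothesis (W.conductorNorm ℤ) K → SatisfiesHeegnerHypothesis p K →
      (W.baseChange K).HasIrreducibleModPGaloisRep p →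
      ∀ (κ : ZpExtension K p), κ.IsAnticyclotomic → ∀ (γ : Field.absoluteGaloisGroup K),
      κ.IsTopGenerator γ →
      ∀ (Dt : ModularParametrizationData W (W.conductorNorm ℤ))
        (H : HeegnerDatum (W.conductorNorm ℤ) (NumberField.discr K)) (ιC : K →+* ℂ),
      ¬ (p : ℤ) ∣ Dt.c → (W.baseChange K).mordellWeilRank = 1 →
      Finite (AddCommGroup.primaryComponent (W.baseChange K).sha p) →
      ¬ p ∣ NumberField.classNumber K →
      ∃ (jbar : AlgebraicClosure K →+* ℂ) (D : (W.baseChange K).LambdaAdicSelmerData κ γ)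
        (F : HeegnerFamily (W.conductorNorm ℤ) W K κ jbar) (X : (W.baseChange K).SelmerDualData κ γ),
        F.Dt = Dt ∧ heegnerCharIdeal D F ^ 2 ≤
          Module.charIdeal (IwasawaAlgebra p) (Submodule.torsion (IwasawaAlgebra p) X.X) := by
  intro W _ _ p _ _ K _ _ hX9 hK hodd h3 hHN hHp _ κ hκ γ hγ Dt H ιC _ _ _ hhK
  letI : Algebra K ℂ := ιC.toAlgebra
  let jbar : AlgebraicClosure K →+* ℂ :=
    (IsAlgClosed.lift (R := K) (M := ℂ) (S := AlgebraicClosure K)).toRingHom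
  exact ⟨jbar, heegnerContainmentAt_lightTied_of_mastellaZerman hMZ hX9 hK hodd h3 hHN hHp hhK κ hκ γ hγ
    Dt H jbar⟩

/-- **The pinned A-side `HowardContainmentLightFramePinned` (item stmt-BirchSwinnertonDyer-26356 = the CONCLUSION of
the deciding crux stmt-BirchSwinnertonDyer-26359 `HowardContainmentLightFramePinnedOfPrint := MastellaZermanHowardDivisibility →
CGLSHowardDivisibilityLocalized → AnticyclotomicTowerInRingClassFields → HowardContainmentLightFramePinned`; for the
rev-20–24 binder list `h hMZ hCGLS hTw : HowardContainmentLightFramePinned`) specialises to the rung's statement**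
(one more hypothesis, otherwise its letter): the kernel certificate that `rung_lightPinned_coprimeClassNumber` IS the
`p ∤ h_K` special case of the crux's conclusion BY ID. Typed over the A-side rather than over the crux so that a
re-binding of the crux (REF-117 R1/R2) does not touch this file. [kernel bookkeeping; no mathematical content] -/
theorem rung_isSlice_lightPinned (hA : HowardContainmentLightFramePinned) :
    ∀ (W : WeierstrassCurve ℚ) [W.IsElliptic] [W.IsGloballyMinimal] (p : ℕ) [Fact p.Prime]
      [NeZero (W.conductorNorm ℤ)] (K : Type) [Field K] [NumberField K],
      Summit.BirchSwinnertonDyer.BirchSwinnertonDyer.Rank1Residual.ClassX9 W p →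
      IsImaginaryQuadratic K → Odd (NumberField.discr K) → NumberField.discr K ≠ -3 →
      SatisfiesHeegnerHypothesis (W.conductorNorm ℤ) K → SatisfiesHeegnerHypothesis p K →
      (W.baseChange K).HasIrreducibleModPGaloisRep p →
      ∀ (κ : ZpExtension K p), κ.IsAnticyclotomic → ∀ (γ : Field.absoluteGaloisGroup K),
      κ.IsTopGenerator γ →
      ∀ (Dt : ModularParametrizationData W (W.conductorNorm ℤ))
        (H : HeegnerDatum (W.conductorNorm ℤ) (NumberField.discr K)) (ιC : K →+* ℂ),
      ¬ (p : ℤ) ∣ Dt.c → (W.baseChange K).mordellWeilRank = 1 →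
      Finite (AddCommGroup.primaryComponent (W.baseChange K).sha p) →
      ¬ p ∣ NumberField.classNumber K →
      ∃ (jbar : AlgebraicClosure K →+* ℂ) (D : (W.baseChange K).LambdaAdicSelmerData κ γ)
        (F : HeegnerFamily (W.conductorNorm ℤ) W K κ jbar) (X : (W.baseChange K).SelmerDualData κ γ),
        F.Dt = Dt ∧ heegnerCharIdeal D F ^ 2 ≤
          Module.charIdeal (IwasawaAlgebra p) (Submodule.torsion (IwasawaAlgebra p) X.X) := by
  intro W _ _ p _ _ K _ _ hX9 hK hodd h3 hHN hHp hirr κ hκ γ hγ Dt H ιC hc hrk hfin _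
  exact hA W p K hX9 hK hodd h3 hHN hHp hirr κ hκ γ hγ Dt H ιC hc hrk hfin

/-! ## §4 The skeleton-of-record stub statement `Stmt.coprimeTied`, proved route-internally -/

/-- **`Stmt.coprimeTied` of the registered skeleton on stmt-BirchSwinnertonDyer-26359 (line `torsion-depth-pinned`,
x9-p1 LEAD re-cut, sha256 b026ade8…), VERBATIM**: `hMZ →` light X9 frame with a GIVEN `jbar` `→ ¬ (p : ℤ) ∣ Dt.c →
rank E(K) = 1 → Ш[p^∞] finite → ¬ p ∣ h_K → ∃ D F X, F.Dt = Dt ∧ I(ℋ_F)² ⊆ char_Λ(X_tors)`. In a line file: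
`theorem stub_coprimeTied : Stmt.coprimeTied := PrintX9Rung.stmt_coprimeTied` (definitional unfolding), with no
import of another route's `Theses`. PRINT regime. [cite: MastellaZerman2026, Cor. 4.6 (arXiv:2505.08710)]
[cite: Howard2004HeegnerKolyvagin, Thm. B] -/
theorem stmt_coprimeTied : MastellaZermanHowardDivisibility →
    ∀ (W : WeierstrassCurve ℚ) [W.IsElliptic] [W.IsGloballyMinimal] (p : ℕ) [Fact p.Prime]
      [NeZero (W.conductorNorm ℤ)] (K : Type) [Field K] [NumberField K],
      Summit.BirchSwinnertonDyer.BirchSwinnertonDyer.Rank1Residual.ClassX9 W p →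
      IsImaginaryQuadratic K → Odd (NumberField.discr K) → NumberField.discr K ≠ -3 →
      SatisfiesHeegnerHypothesis (W.conductorNorm ℤ) K → SatisfiesHeegnerHypothesis p K →
      (W.baseChange K).HasIrreducibleModPGaloisRep p →
      ∀ (κ : ZpExtension K p), κ.IsAnticyclotomic → ∀ (γ : Field.absoluteGaloisGroup K),
      κ.IsTopGenerator γ →
      ∀ (Dt : ModularForms.ModularParametrizationData W (W.conductorNorm ℤ))
        (H : HeegnerDatum (W.conductorNorm ℤ) (NumberField.discr K)) (ιC : K →+* ℂ)
        (jbar : AlgebraicClosure K →+* ℂ),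
      ¬ (p : ℤ) ∣ Dt.c → (W.baseChange K).mordellWeilRank = 1 →
      Finite (AddCommGroup.primaryComponent (W.baseChange K).sha p) →
      ¬ p ∣ NumberField.classNumber K →
      ∃ (D : (W.baseChange K).LambdaAdicSelmerData κ γ)
        (F : HeegnerFamily (W.conductorNorm ℤ) W K κ jbar) (X : (W.baseChange K).SelmerDualData κ γ),
        F.Dt = Dt ∧ heegnerCharIdeal D F ^ 2 ≤
          Module.charIdeal (IwasawaAlgebra p) (Submodule.torsion (IwasawaAlgebra p) X.X) := by
  intro hMZ W _ _ p _ _ K _ _ hX9 hK hodd h3 hHN hHp _ κ hκ γ hγ Dt H _ jbar _ _ _ hhK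
  exact heegnerContainmentAt_lightTied_of_mastellaZerman hMZ hX9 hK hodd h3 hHN hHp hhK κ hκ γ hγ Dt H jbar

/-! ## §5 LEVER REGIME by ID: localized at `p`, ANY class number, TIED to `Dt`, torsion depth typed -/

/-- **CGLS 2022 Thm. 4.1.3 (localized Howard divisibility, any `h_K`) on a light X9 frame for the TIED
stabilised datum at a GIVEN `jbar`** — from the route binders `hCGLS` and `hTw` BY NAME: data `D`, `X` exist;
the `d(k)`-shifted stabilised Heegner datum `C` ON `Dt` (orientation `H.β`), WITH its torsion-depth
characterisation `0 < C.depth ↔ K_1 ⊆ K[1]`, by x9-p2's `X9.exists_stabilizedHeegnerData_of_tower` (fed `hTw`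
at the frame); CGLS's hypotheses by `X9.thm413Hypotheses_of_lightFrame` (no class-number input); Selmer corank
one by `X9.selmerCorank_eq_one_of_rank_one`; then `span_pow_mul_sq_le_charIdeal_torsion_of_thm413`. Tied
re-run of x9-p2's `X9.stabilizedLocalizedContainmentAt_of_thm413_of_tower` (p607064) keeping `C.Dt = Dt` and
the depth clause. PRINT modulo typing; LOCALIZED (`p^m`), module `Λκ_∞(C)` not `ℋ_F`.
[cite: CastellaGrossiLeeSkinner2022, Thm. 4.1.3 + Cor. 3.4.2 + Rem. 4.1.4; Thm. 4.1.1 proof (d(k)) (arXiv:2008.02571 p. 22)]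
[cite: PerrinRiou1987BSMF, §1 (K_∞ ⊂ K[p^∞])] [cite: GreenbergLNM1716, §1] -/
theorem stabilizedLocalizedContainmentAt_tied_of_thm413_of_tower
    (hCGLS : CGLSHowardDivisibilityLocalized) (hTw : AnticyclotomicTowerInRingClassFields)
    {W : WeierstrassCurve ℚ} [W.IsElliptic] [W.IsGloballyMinimal] {p : ℕ} [Fact p.Prime]
    [NeZero (W.conductorNorm ℤ)] {K : Type} [Field K] [NumberField K]
    (hX9 : Summit.BirchSwinnertonDyer.BirchSwinnertonDyer.Rank1Residual.ClassX9 W p)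
    (hK : IsImaginaryQuadratic K) (hodd : Odd (NumberField.discr K)) (h3 : NumberField.discr K ≠ -3)
    (hHN : SatisfiesHeegnerHypothesis (W.conductorNorm ℤ) K) (hHp : SatisfiesHeegnerHypothesis p K)
    (κ : ZpExtension K p) (hκ : κ.IsAnticyclotomic)
    (γ : Field.absoluteGaloisGroup K) (hγ : κ.IsTopGenerator γ)
    (Dt : ModularParametrizationData W (W.conductorNorm ℤ))
    (H : HeegnerDatum (W.conductorNorm ℤ) (NumberField.discr K))
    (jbar : AlgebraicClosure K →+* ℂ)
    (hrk : (W.baseChange K).mordellWeilRank = 1)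
    (hfin : Finite (AddCommGroup.primaryComponent (W.baseChange K).sha p)) :
    ∃ (D : (W.baseChange K).LambdaAdicSelmerData κ γ)
      (C : CastellaGrossiLeeSkinner2022.StabilizedHeegnerData (W.conductorNorm ℤ) W K κ jbar)
      (X : (W.baseChange K).SelmerDualData κ γ) (m : ℕ),
      C.Dt = Dt ∧ (0 < C.depth ↔ ringClassSubgroup K 1 jbar ≤ κ.layerSubgroup 1) ∧
      Ideal.span {((p : IwasawaAlgebra p) ^ m)} *
          CastellaGrossiLeeSkinner2022.stabilizedHeegnerCharIdeal D C ^ 2 ≤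
        Module.charIdeal (IwasawaAlgebra p) (Submodule.torsion (IwasawaAlgebra p) X.X) := by
  have hX9' :=
    Summit.BirchSwinnertonDyer.BirchSwinnertonDyer.Rank1Residual.classX9_census_of_classX9 W p hX9
  have hp_odd : Odd p := (Fact.out : p.Prime).odd_of_ne_two hX9'.ne_two
  obtain ⟨D⟩ := LambdaAdicSelmerDataExists.nonempty_lambdaAdicSelmerData (W.baseChange K) p κ hγ
  obtain ⟨X⟩ := (W.baseChange K).nonempty_selmerDualData_holds κ γ hγ
  obtain ⟨C, hCDt, -, hdepth⟩ :=
    Summit.BirchSwinnertonDyer.Rank1Residual.X9.exists_stabilizedHeegnerData_of_tower (κ := κ)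
      (jbar := jbar) hK hHN hX9'.not_dvd_conductorNorm Dt H.dvd_sq_sub
      (fun k ↦ hTw K p hp_odd hK κ hκ jbar k)
  obtain ⟨m, hm⟩ := CastellaGrossiLeeSkinner2022.span_pow_mul_sq_le_charIdeal_torsion_of_thm413
    (thm413_of_cglsHowardDivisibilityLocalized hCGLS)
    (Summit.BirchSwinnertonDyer.Rank1Residual.X9.thm413Hypotheses_of_lightFrame hX9' hK hodd h3 hHN hHp
      hκ hγ)
    (Summit.BirchSwinnertonDyer.Rank1Residual.X9.selmerCorank_eq_one_of_rank_one hrk hfin) D C X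
  exact ⟨D, C, X, m, hCDt, hdepth, hm⟩

/-- **Lever-regime rung, TIED, any class number, any depth = `Stmt.localizedTied` of the skeleton of record
VERBATIM** (`hCGLS → hTw →` light frame with GIVEN `jbar` `→ pin → rank one → Ш finite → ∃ D C X m, C.Dt = Dt ∧
(p^m)·I(Λκ_∞(C))² ⊆ char_Λ(X_tors)`), from the two route binders BY NAME. PRINT modulo typing; localized.
[cite: CastellaGrossiLeeSkinner2022, Thm. 4.1.3 + Rem. 4.1.4 (arXiv:2008.02571, p. 22)] -/
theorem rung_lightPinned_localizedTied :
    CGLSHowardDivisibilityLocalized → AnticyclotomicTowerInRingClassFields →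
    ∀ (W : WeierstrassCurve ℚ) [W.IsElliptic] [W.IsGloballyMinimal] (p : ℕ) [Fact p.Prime]
      [NeZero (W.conductorNorm ℤ)] (K : Type) [Field K] [NumberField K],
      Summit.BirchSwinnertonDyer.BirchSwinnertonDyer.Rank1Residual.ClassX9 W p →
      IsImaginaryQuadratic K → Odd (NumberField.discr K) → NumberField.discr K ≠ -3 →
      SatisfiesHeegnerHypothesis (W.conductorNorm ℤ) K → SatisfiesHeegnerHypothesis p K →
      (W.baseChange K).HasIrreducibleModPGaloisRep p →
      ∀ (κ : ZpExtension K p), κ.IsAnticyclotomic → ∀ (γ : Field.absoluteGaloisGroup K),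
      κ.IsTopGenerator γ →
      ∀ (Dt : ModularForms.ModularParametrizationData W (W.conductorNorm ℤ))
        (H : HeegnerDatum (W.conductorNorm ℤ) (NumberField.discr K)) (ιC : K →+* ℂ)
        (jbar : AlgebraicClosure K →+* ℂ),
      ¬ (p : ℤ) ∣ Dt.c → (W.baseChange K).mordellWeilRank = 1 →
      Finite (AddCommGroup.primaryComponent (W.baseChange K).sha p) →
      ∃ (D : (W.baseChange K).LambdaAdicSelmerData κ γ)
        (C : CastellaGrossiLeeSkinner2022.StabilizedHeegnerData (W.conductorNorm ℤ) W K κ jbar)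
        (X : (W.baseChange K).SelmerDualData κ γ) (m : ℕ),
        C.Dt = Dt ∧ Ideal.span {((p : IwasawaAlgebra p) ^ m)} *
            CastellaGrossiLeeSkinner2022.stabilizedHeegnerCharIdeal D C ^ 2 ≤
          Module.charIdeal (IwasawaAlgebra p) (Submodule.torsion (IwasawaAlgebra p) X.X) := by
  intro hCGLS hTw W _ _ p _ _ K _ _ hX9 hK hodd h3 hHN hHp _ κ hκ γ hγ Dt H _ jbar _ hrk hfin
  obtain ⟨D, C, X, m, hCDt, -, hm⟩ := stabilizedLocalizedContainmentAt_tied_of_thm413_of_tower hCGLS hTw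
    hX9 hK hodd h3 hHN hHp κ hκ γ hγ Dt H jbar hrk hfin
  exact ⟨D, C, X, m, hCDt, hm⟩

/-- **Lever-regime rung with the FIRST TORSION LAYER TYPED (`K_1 ⊆ K[1]`, i.e. `δ ≥ 1`, which forces
`p ∣ h_K` since `[K_1 : K] = p` divides `[K[1] : K] = h_K`) and the depth of the produced CGLS datum CERTIFIED
positive** — the complement of the witness regime of §3, from `hCGLS` + `hTw` BY NAME, tied to `Dt`.
LOCALIZED (`p^m`); the integral promotion (μ-part) is the route's open residual, untouched.
[cite: CastellaGrossiLeeSkinner2022, Thm. 4.1.1 proof (d(k) > 0 layers) and Thm. 4.1.3 (arXiv:2008.02571 p. 22)]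
[cite: PerrinRiou1987BSMF, §3.1] -/
theorem rung_lightPinned_depthPos_localizedTied
    (hCGLS : CGLSHowardDivisibilityLocalized) (hTw : AnticyclotomicTowerInRingClassFields) :
    ∀ (W : WeierstrassCurve ℚ) [W.IsElliptic] [W.IsGloballyMinimal] (p : ℕ) [Fact p.Prime]
      [NeZero (W.conductorNorm ℤ)] (K : Type) [Field K] [NumberField K],
      Summit.BirchSwinnertonDyer.BirchSwinnertonDyer.Rank1Residual.ClassX9 W p →
      IsImaginaryQuadratic K → Odd (NumberField.discr K) → NumberField.discr K ≠ -3 →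
      SatisfiesHeegnerHypothesis (W.conductorNorm ℤ) K → SatisfiesHeegnerHypothesis p K →
      (W.baseChange K).HasIrreducibleModPGaloisRep p →
      ∀ (κ : ZpExtension K p), κ.IsAnticyclotomic → ∀ (γ : Field.absoluteGaloisGroup K),
      κ.IsTopGenerator γ →
      ∀ (Dt : ModularForms.ModularParametrizationData W (W.conductorNorm ℤ))
        (H : HeegnerDatum (W.conductorNorm ℤ) (NumberField.discr K)) (ιC : K →+* ℂ)
        (jbar : AlgebraicClosure K →+* ℂ),
      ¬ (p : ℤ) ∣ Dt.c → (W.baseChange K).mordellWeilRank = 1 →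
      Finite (AddCommGroup.primaryComponent (W.baseChange K).sha p) →
      ringClassSubgroup K 1 jbar ≤ κ.layerSubgroup 1 →
      ∃ (D : (W.baseChange K).LambdaAdicSelmerData κ γ)
        (C : CastellaGrossiLeeSkinner2022.StabilizedHeegnerData (W.conductorNorm ℤ) W K κ jbar)
        (X : (W.baseChange K).SelmerDualData κ γ) (m : ℕ),
        C.Dt = Dt ∧ 0 < C.depth ∧ Ideal.span {((p : IwasawaAlgebra p) ^ m)} *
            CastellaGrossiLeeSkinner2022.stabilizedHeegnerCharIdeal D C ^ 2 ≤
          Module.charIdeal (IwasawaAlgebra p) (Submodule.torsion (IwasawaAlgebra p) X.X) := by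
  intro W _ _ p _ _ K _ _ hX9 hK hodd h3 hHN hHp _ κ hκ γ hγ Dt H _ jbar _ hrk hfin hδ
  obtain ⟨D, C, X, m, hCDt, hdepth, hm⟩ := stabilizedLocalizedContainmentAt_tied_of_thm413_of_tower
    hCGLS hTw hX9 hK hodd h3 hHN hHp κ hκ γ hγ Dt H jbar hrk hfin
  exact ⟨D, C, X, m, hCDt, hdepth.mpr hδ, hm⟩

/-! ## §6 Both regimes of the deciding crux from its three binders, BY ID -/

/-- **Both regimes of `HowardContainmentLightFramePinnedOfPrint` exercised from its three print binders
(`hMZ`, `hCGLS`, `hTw`)** on every rank-one light X9 frame, for the frame's own `Dt` and a GIVEN `jbar`: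
`p ∤ h_K` ⟹ the crux's conclusion INTEGRALLY (§2); at ANY class number ⟹ its LOCALIZED truncation for the
stabilised module, tied, with the depth clause (§5). What separates this from the crux is exactly the route's
open pair (envelope `stub_envelopeTied`, μ-part `stub_muPartTied`). BSD / BSD_p(X9) / the crux are NOT proved.
[cite: MastellaZerman2026, Cor. 4.6 (arXiv:2505.08710)]
[cite: CastellaGrossiLeeSkinner2022, Thm. 4.1.3 + Rem. 4.1.4 (arXiv:2008.02571)] -/
theorem rung_twoRegimes_lightPinned (hMZ : MastellaZermanHowardDivisibility)
    (hCGLS : CGLSHowardDivisibilityLocalized) (hTw : AnticyclotomicTowerInRingClassFields)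
    {W : WeierstrassCurve ℚ} [W.IsElliptic] [W.IsGloballyMinimal] {p : ℕ} [Fact p.Prime]
    [NeZero (W.conductorNorm ℤ)] {K : Type} [Field K] [NumberField K]
    (hX9 : Summit.BirchSwinnertonDyer.BirchSwinnertonDyer.Rank1Residual.ClassX9 W p)
    (hK : IsImaginaryQuadratic K) (hodd : Odd (NumberField.discr K)) (h3 : NumberField.discr K ≠ -3)
    (hHN : SatisfiesHeegnerHypothesis (W.conductorNorm ℤ) K) (hHp : SatisfiesHeegnerHypothesis p K)
    (κ : ZpExtension K p) (hκ : κ.IsAnticyclotomic)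
    (γ : Field.absoluteGaloisGroup K) (hγ : κ.IsTopGenerator γ)
    (Dt : ModularParametrizationData W (W.conductorNorm ℤ))
    (H : HeegnerDatum (W.conductorNorm ℤ) (NumberField.discr K))
    (jbar : AlgebraicClosure K →+* ℂ)
    (hrk : (W.baseChange K).mordellWeilRank = 1)
    (hfin : Finite (AddCommGroup.primaryComponent (W.baseChange K).sha p)) :
    (¬ p ∣ NumberField.classNumber K →
      ∃ (D : (W.baseChange K).LambdaAdicSelmerData κ γ)
        (F : HeegnerFamily (W.conductorNorm ℤ) W K κ jbar) (X : (W.baseChange K).SelmerDualData κ γ),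
        F.Dt = Dt ∧ heegnerCharIdeal D F ^ 2 ≤
          Module.charIdeal (IwasawaAlgebra p) (Submodule.torsion (IwasawaAlgebra p) X.X)) ∧
    (∃ (D : (W.baseChange K).LambdaAdicSelmerData κ γ)
      (C : CastellaGrossiLeeSkinner2022.StabilizedHeegnerData (W.conductorNorm ℤ) W K κ jbar)
      (X : (W.baseChange K).SelmerDualData κ γ) (m : ℕ),
      C.Dt = Dt ∧ (0 < C.depth ↔ ringClassSubgroup K 1 jbar ≤ κ.layerSubgroup 1) ∧
      Ideal.span {((p : IwasawaAlgebra p) ^ m)} *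
          CastellaGrossiLeeSkinner2022.stabilizedHeegnerCharIdeal D C ^ 2 ≤
        Module.charIdeal (IwasawaAlgebra p) (Submodule.torsion (IwasawaAlgebra p) X.X)) :=
  ⟨fun hhK ↦ heegnerContainmentAt_lightTied_of_mastellaZerman hMZ hX9 hK hodd h3 hHN hHp hhK κ hκ γ hγ
      Dt H jbar,
    stabilizedLocalizedContainmentAt_tied_of_thm413_of_tower hCGLS hTw hX9 hK hodd h3 hHN hHp κ hκ γ hγ
      Dt H jbar hrk hfin⟩

end Summit.BirchSwinnertonDyer.BirchSwinnertonDyer.Theorems.PrintX9Rung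

end
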